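import Literature.IUT.LogVolume.PilotDataBaseChange
import Literature.IUT.HodgeTheaters.InitialThetaDataQParamRootValuationProofs
import Literature.NumberTheory.EllipticCurves.MultiplicativeReductionJValuationProofs
import HarnessLib

/-!
# [IUTchI] Ex. 3.2 (iv) for Dupuy–Hilado pilot data OVER `K`: `2l ∣ ord_w(q_w)` at every prime of `K = F(E_F[l])`
# over `𝕍(F)^bad` — the divisibility that makes REALISING ideles exist, PROVED from the initial Θ-datum

Mochizuki, *Inter-universal Teichmüller theory I*, kurims May-2020 manuscript, Example 3.2 (iv) p. 71: "it follows
from our assumption concerning `2`-torsion [cf. Definition 3.1, (b)], together with the definition of “`K`” [cf.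
Definition 3.1, (c)], that `q_v` admits a `2l`-th root in `𝒪^▷_{K_v̲}`"; Dupuy–Hilado, arXiv:2004.13228 §3.3: `P_q :=
Σ_{v∈S} ord_v(q̲_v)[v]`, `q̲_v = q_v^{1/2l}`, with (§3.2) `ord_v(q_v) = −ord_v(j_E)`.

PROOF-ONLY file (no definition, no new `Prop`, no instance; classical; TAKES NO SIDE on [IUTchIII] Cor. 3.12). For
the cell abc-iut's repair R1 of the «genuine-setting» certificates (a `K`-LEVEL Dupuy–Hilado pilot datum
`Y = (K, j_E, S_K, l)` over an initial Θ-datum `D` on `(F, E_F, l)`, abc-iut-C-cert-3; companion of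
`PilotDataBaseChange.lean`): the hypothesis `hdiv : ∀ w ∈ S_K, 2l ∣ ord_w(q_w)` of abc-iut-c312-3's
`exists_realising_qIdeles` / `exists_realising_thetaIdeles` is a THEOREM at the `K`-level — NOT a named fact —
because the tree PROVES the valuation half of Ex. 3.2 (iv) from the typed Def. 3.1 (abc-iut-w5-d158's
`InitialThetaData.two_mul_dvd_ordMinimalDiscriminant_baseChange`: `2l ∣ ord_w(Δ_min(E_F ⊗ K))` at EVERY finite place
`w` of `K` over `𝕍(F)^bad`, all hypotheses discharged from Def. 3.1 (b)(c); Silverman *AEC* VII.5.1/VII.6.1, *ATAEC*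
V.6.1) and `ord_w(Δ_min(E_K)) = −ord_w(j_E)` at a multiplicative place (Silverman VII.5.1 (b), the tree's
`log_valuation_j_eq_ordMinimalDiscriminant_of_hasMultiplicativeReductionAt`). Results, for
`D : InitialThetaData F K Fbar E l P`, a finite place `w` of `K` over `x ∈ 𝕍(F)^bad`:

* `InitialThetaData.neg_ord_j_baseChange_eq_ordMinimalDiscriminant` — `−ord_w(j_E) = ord_w(Δ_min(E_F ⊗ K))`;
* **`InitialThetaData.two_mul_l_dvd_neg_ord_j`** — `2l ∣ −ord_w(j_E)`;
* the same indexed by `finBelow` (`…_of_finBelow_mem`, the convention of `PilotDataBaseChange.lean`);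
* **`PilotData.two_mul_l_dvd_ordq_of_jE_eq`** — for ANY `K`-level pilot datum `Y` with `Y.jE = j_E` (viewed in `K`)
  and `Y.l = l`: `2·Y.l ∣ Y.ordq w` at every `w` over `𝕍(F)^bad`, and **`PilotData.forall_two_mul_l_dvd_ordq`** —
  the `hdiv` binder of `exists_realising_qIdeles` VERBATIM (`∀ w ∈ Y.S, (2 * (Y.l : ℤ)) ∣ Y.ordq w`) as soon as
  `S_K` lies over `𝕍(F)^bad`.

So at the `K`-level the idele side conditions of the Cor. 3.12 certificates are SATISFIABLE (contrast:
`Conditional/AbcOfSGenuineSideVacuity.lean`, over `F` they are not, by Def. 3.1 (c)). Honest scope: the `2l`-th ROOT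
itself (unit part) is not claimed — only valuations are read by the log-volume computations.
[cite: Mochizuki2012, IUTchI Ex. 3.2 (iv) p. 71; Def. 3.1 (b)(c) pp. 61–62] [cite: DupuyHilado2025, §3.2–3.3]
[cite: SilvermanAEC2009, VII.5 Prop. 5.1(b)] IUT locators carry [claim: Mochizuki2012, status: disputed] as a
bibliographic status; the mathematics is classical.
-/

noncomputable section

open scoped Classical
open NumberField IsDedekindDomain

universe u

namespace Literature.IUT.HodgeTheaters

namespace InitialThetaData

open WeierstrassCurve Literature.IUT.LogVolume

variable {F : Type u} {K : Type u} {Fbar : Type u} [Field F] [NumberField F] [Field K] [NumberField K]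
  [Algebra F K] [Field Fbar] [Algebra F Fbar] [Algebra K Fbar] {E : WeierstrassCurve F} [E.IsElliptic]
  {l : ℕ} {P : BadPlacePredicates K}

/-- **`−ord_w(j_E) = ord_w(Δ_min(E_F ⊗ K))`** at a finite place `w` of `K` over `x ∈ 𝕍(F)^bad`: `E_F ⊗ K` has
multiplicative reduction at `w` (the tree's `hasMultiplicativeReductionAt_baseChange`, Def. 3.1 (b) read over `K`),
and at a multiplicative place `ord(j) = −ord(Δ_min)` (Silverman *AEC* VII.5.1 (b)); `j(E_F ⊗ K) = j_E`.
[cite: SilvermanAEC2009, VII.5 Prop. 5.1(b)] [cite: Mochizuki2012, IUTchI Def. 3.1 (b) p. 61] -/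
theorem neg_ord_j_baseChange_eq_ordMinimalDiscriminant (D : InitialThetaData F K Fbar E l P)
    {x : FinitePlace F} (hx : x ∈ D.VFbad) (w : HeightOneSpectrum (𝓞 K))
    [w.asIdeal.LiesOver x.maximalIdeal.asIdeal] :
    -ord K w (algebraMap F K E.j) = ((E.baseChange K).ordMinimalDiscriminant w : ℤ) := by
  haveI : (E.baseChange K).IsElliptic := inferInstanceAs (E.map (algebraMap F K)).IsElliptic
  have hmult := D.hasMultiplicativeReductionAt_baseChange hx w
  rw [← (E.baseChange K).log_valuation_j_eq_ordMinimalDiscriminant_of_hasMultiplicativeReductionAt w hmult,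
    show (E.baseChange K).j = algebraMap F K E.j from E.map_j _]
  unfold ord
  ring

/-- **[IUTchI] Ex. 3.2 (iv) for the `j`-invariant: `2l ∣ −ord_w(j_E)`** at every finite place `w` of `K` over
`x ∈ 𝕍(F)^bad` — Dupuy–Hilado's `ord_w(q_w) := −ord_w(j_E)` is divisible by `2l`, i.e. `ord_w(q̲_w) ∈ ℤ` over `K`.
All hypotheses from the datum (the tree's `two_mul_dvd_ordMinimalDiscriminant_baseChange`).
[cite: Mochizuki2012, IUTchI Ex. 3.2 (iv) p. 71] [cite: DupuyHilado2025, §3.2–3.3] -/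
theorem two_mul_l_dvd_neg_ord_j (D : InitialThetaData F K Fbar E l P)
    {x : FinitePlace F} (hx : x ∈ D.VFbad) (w : HeightOneSpectrum (𝓞 K))
    [w.asIdeal.LiesOver x.maximalIdeal.asIdeal] :
    (2 * (l : ℤ)) ∣ -ord K w (algebraMap F K E.j) := by
  rw [D.neg_ord_j_baseChange_eq_ordMinimalDiscriminant hx w]
  exact_mod_cast D.two_mul_dvd_ordMinimalDiscriminant_baseChange hx w

/-- The same indexed by the prime UNDER `w` (`finBelow F K w = w ∩ 𝓞_F`, the convention of
`PilotDataBaseChange.lean`): if the finite place of `F` under `w` lies in `𝕍(F)^bad`, then `2l ∣ −ord_w(j_E)`.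
[cite: Mochizuki2012, IUTchI Ex. 3.2 (iv) p. 71] -/
theorem two_mul_l_dvd_neg_ord_j_of_finBelow_mem (D : InitialThetaData F K Fbar E l P)
    (w : HeightOneSpectrum (𝓞 K)) (hw : FinitePlace.mk (finBelow F K w) ∈ D.VFbad) :
    (2 * (l : ℤ)) ∣ -ord K w (algebraMap F K E.j) := by
  haveI : w.asIdeal.LiesOver (FinitePlace.mk (finBelow F K w)).maximalIdeal.asIdeal := by
    rw [FinitePlace.maximalIdeal_mk]
    exact liesOver_finBelow (F := F) (K := K) w
  exact D.two_mul_l_dvd_neg_ord_j hw w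

/-- `E_F ⊗ K` has multiplicative reduction at every finite place of `K` whose restriction to `F` lies in `𝕍(F)^bad`
(`finBelow` form of the tree's `hasMultiplicativeReductionAt_baseChange`). [cite: Mochizuki2012, IUTchI Def. 3.1 (b)(e) pp. 61–62] -/
theorem hasMultiplicativeReductionAt_baseChange_of_finBelow_mem (D : InitialThetaData F K Fbar E l P)
    (w : HeightOneSpectrum (𝓞 K)) (hw : FinitePlace.mk (finBelow F K w) ∈ D.VFbad) :
    (E.baseChange K).HasMultiplicativeReductionAt w := by
  haveI : w.asIdeal.LiesOver (FinitePlace.mk (finBelow F K w)).maximalIdeal.asIdeal := by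
    rw [FinitePlace.maximalIdeal_mk]
    exact liesOver_finBelow (F := F) (K := K) w
  exact D.hasMultiplicativeReductionAt_baseChange hw w

end InitialThetaData

end Literature.IUT.HodgeTheaters

namespace Literature.IUT.LogVolume

namespace PilotData

open Literature.IUT.HodgeTheaters

variable {F : Type u} {K : Type u} {Fbar : Type u} [Field F] [NumberField F] [Field K] [NumberField K]
  [Algebra F K] [Field Fbar] [Algebra F Fbar] [Algebra K Fbar] {E : WeierstrassCurve F} [E.IsElliptic]
  {l : ℕ} {P : BadPlacePredicates K}

/-- **`2l ∣ ord_w(q_w)` for a `K`-level Dupuy–Hilado pilot datum of an initial Θ-datum**: for ANY pilot data `Y`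
over `K` with `j`-invariant `j_E` (viewed in `K`) and auxiliary prime `l`, at every finite place `w` of `K` whose
restriction to `F` lies in `𝕍(F)^bad`, `2·Y.l ∣ Y.ordq w` (`Y.ordq w = −ord_w(j_E)`).
[cite: Mochizuki2012, IUTchI Ex. 3.2 (iv) p. 71] [cite: DupuyHilado2025, §3.3] -/
theorem two_mul_l_dvd_ordq_of_jE_eq (D : InitialThetaData F K Fbar E l P) (Y : PilotData K)
    (hj : Y.jE = algebraMap F K E.j) (hl : Y.l = l)
    {w : HeightOneSpectrum (𝓞 K)} (hw : FinitePlace.mk (finBelow F K w) ∈ D.VFbad) :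
    (2 * (Y.l : ℤ)) ∣ Y.ordq w := by
  unfold ordq
  rw [hj, hl]
  exact D.two_mul_l_dvd_neg_ord_j_of_finBelow_mem w hw

/-- **The `hdiv` binder of abc-iut-c312-3's `exists_realising_qIdeles` / `exists_realising_thetaIdeles`, DISCHARGED
at the `K`-level**: if the bad set `S_K` of the `K`-level datum lies over `𝕍(F)^bad` (e.g. `S_K` = all primes of `K`
over `𝕍(F)^bad`), then `∀ w ∈ Y.S, 2·Y.l ∣ Y.ordq w` — so q-ideles and Θ-ideles in the completions `K_w` REALISING
`P_q`, `P_Θ` exist. [cite: Mochizuki2012, IUTchI Ex. 3.2 (iv) p. 71] [cite: DupuyHilado2025, §3.3–3.4] -/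
theorem forall_two_mul_l_dvd_ordq (D : InitialThetaData F K Fbar E l P) (Y : PilotData K)
    (hj : Y.jE = algebraMap F K E.j) (hl : Y.l = l)
    (hS : ∀ w ∈ Y.S, FinitePlace.mk (finBelow F K w) ∈ D.VFbad) :
    ∀ w ∈ Y.S, (2 * (Y.l : ℤ)) ∣ Y.ordq w :=
  fun w hw => two_mul_l_dvd_ordq_of_jE_eq D Y hj hl (hS w hw)

end PilotData

end Literature.IUT.LogVolume

end
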